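import Summits.BirchSwinnertonDyer.Rank1Residual.X12.InertCoreUpperHalfTam
import Literature.NumberTheory.EllipticCurves.AgasheRibetStein2006.ManinConstantX12Core
import Literature.NumberTheory.EllipticCurves.CuspFormLFunctionLevelConductorProofs
import HarnessLib

/-!
# X12 inert-bad core, per pair: the Manin datum from Cremona's table (the 84 core curves are
# `X₀(N)`-optimal with `c = 1`), and `BSD(E,p)` from the upper half plus `ord_p #Ш(E)_an = 0`
# — route "T-KR" (Kolyvagin bound ∘ Rubin cancellation): NO Heegner index, NO descent

HONEST FRAMING (cell `b2b-bsdres`, run/shared/lean/b2b/bsd-rank1-residual/, verbatim in every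
file): the goal of the cell is to DELETE the COMBINATION-SHAPED residual classes of the
Birch–Swinnerton-Dyer formula for ALL analytic-rank `≤ 1` elliptic curves over `ℚ` — "full BSD
formula for every rank `≤ 1` curve in class `C`" assembled STRICTLY from published theorems — so
that the rank-`≤ 1` remainder becomes exactly the CONSTRUCTION-SHAPED classes, which are TYPED
(missing-input `Prop`s), NOT attempted. This is not "finishing BSD". Unit `b2b-bsdres-x1b` (X12
prover owner), generation 9; research route, no claim beyond the stated class; X12 REMAINS
CONSTRUCTION-SHAPED; nothing is booked here — booking per pair is the lane's and the referee's.

Theorems only; no definition, no new named fact. Companion of `InertCoreUpperHalf[Tam].lean`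
(class-level UPPER half of `BSD(E,p)` on ClassX12 ∧ `p ≥ 5` ∧ `p` unramified in the CM field,
modulo the Manin datum `p ∤ c(D)`).

* §1 `bsdp_of_classX12_of_not_cmRamified_of_shaAn_unit` — **route T-KR**: at such a pair, if the
  analytic order of `Ш` is a rational number `q` with `ord_p q = 0` (the lane's certified datum,
  72/72 on the core), then `BSD(E,p)` holds: the upper half gives `ord_p #Ш(E) ≤ ord_p q = 0`, so
  `ord_p #Ш(E) = 0 = ord_p #Ш(E)_an`, which is Miller's `BSD(E,p)` in analytic rank one (GZK).
  Compared with T-MN19 (Matar–Nekovář 6.7 (1): Heegner index `p`-adic unit by two implementations,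
  `X12.bsdp_of_matarNekovar_of_not_cmRamified`), the Heegner index does NOT enter: its `p`-part is
  absorbed by `#Ш(E^{(d)})_an`, which Rubin/Burungale–Flach identify with `#Ш(E^{(d)})[p^∞]`.
* §2 `missingUpperBoundAt_of_mem_cremonaCurveOneX12Core` /
  `bsdp_of_mem_cremonaCurveOneX12Core_of_shaAn_unit` — the Manin datum DISCHARGED per pair on the
  84 core curves by Cremona's table (Agashe–Ribet–Stein 2006 Thm. 2.6 + appendix Thm. 5.2, tree
  facts `cremona_abs_maninConstant_eq_one_of_level_le` (harvest-1) and
  `cremona_optimal_curveOne_x12Core` (this unit, `ManinConstantX12Core.lean`): the curve numbered `1`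
  is optimal, `N ≤ 19600 ≤ 130000`, so `|c| = 1`), the level of the optimal datum being the
  conductor by Carayol's theorem in the tree's form (`level_eq_conductorNorm_of_exists_isNewformOf`,
  from `exists_isNewformOf`). What remains per pair: `ClassX12 W p` (CM is decidable from `j`; the
  clause `r_an = 1` is the lane's analytic datum), `5 ≤ p`, `¬ CMRamified W p` (decidable), and for
  `BSD(E,p)` the certified `ord_p #Ш(E)_an = 0`.
-/

noncomputable section

open scoped Classical NumberField

open WeierstrassCurve NumberField Literature.NumberTheory.EllipticCurves
  Literature.NumberTheory.EllipticCurves.ModularForms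
  Literature.NumberTheory.EllipticCurves.AgasheRibetStein2006
  Literature.NumberTheory.EllipticCurves.Rank1Residual
  Literature.NumberTheory.EllipticCurves.Rank1Residual.Typed
  Literature.NumberTheory.Automorphic

namespace Summit.BirchSwinnertonDyer.Rank1Residual.X12

/-! ### §1 Route T-KR: `BSD(E,p)` from the upper half and `ord_p #Ш(E)_an = 0` -/

/-- **Route T-KR on X12 ∧ `p ≥ 5` ∧ unramified**: the class-level UPPER half
(`missingUpperBoundAt_of_classX12_of_not_cmRamified'`, published facts + Manin datum) and the
certified datum "`#Ш(E)_an = q ∈ ℚ` with `ord_p q = 0`" give `BSD(E,p)` (Miller 2011 Def. 1.1, GZK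
for rank and finiteness): `ord_p #Ш(E) ≤ ord_p q = 0`. No Heegner index, no descent.
[cite: MatarNekovar2019, Thm. 0.3 and §0.11] [cite: BurungaleFlach2024, Thm. 1.1 and Cor. 2]
[cite: Miller2011LMS, §1 and Def. 1.1] -/
theorem bsdp_of_classX12_of_not_cmRamified_of_shaAn_unit
    (hGZ : ∀ (N : ℕ) [NeZero N] (W : WeierstrassCurve ℚ) (K : Type) [Field K] [NumberField K],
      gross_zagier N W K)
    (hKo : ∀ (N : ℕ) [NeZero N] (W : WeierstrassCurve ℚ) (K : Type) [Field K] [NumberField K],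
      kolyvagin N W K)
    (hMN : ∀ (N : ℕ) [NeZero N] (W : WeierstrassCurve ℚ) (K : Type) [Field K] [NumberField K],
      MatarNekovar2019.thm03_padicValNat_card_sha_le_of_irreducible N W K)
    (hGZK : rank_eq_analyticRank_of_analyticRank_le_one) (hmod : hasEntireLFunction_rat)
    (hnf : exists_isNewformOf) (hFH : friedbergHoffstein_exists_heegnerField_split_twist_ne_zero)
    (hCM8 : bsdTriple_of_hasCM_of_L_one_ne_zero)
    (W : WeierstrassCurve ℚ) [W.IsElliptic] [W.IsGloballyMinimal] (p : ℕ) [Fact p.Prime]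
    [NeZero (W.conductorNorm ℤ)]
    (hX : ClassX12 W p) (hp5 : 5 ≤ p) (hnr : ¬ CMRamified W p)
    (D : ModularParametrizationData W (W.conductorNorm ℤ)) (hc : ¬ (p : ℤ) ∣ D.c)
    {q : ℚ} (hq : shaAn W = (q : ℂ)) (hv : padicValRat p q = 0) : BSDp W p := by
  obtain ⟨q', hq', hle⟩ := missingUpperBoundAt_of_classX12_of_not_cmRamified' hGZ hKo hMN hGZK hmod
    hnf hFH hCM8 W p hX hp5 hnr D hc
  have hqq : q' = q := by exact_mod_cast hq'.symm.trans hq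
  subst hqq
  rw [hv] at hle
  have h0 : padicValNat p W.shaOrder = 0 := by exact_mod_cast le_antisymm hle (by positivity)
  exact bsdp_of_missingPPartAt W p hGZK (by rw [hX.2.1]) ⟨q', hq', by rw [hv, h0, Nat.cast_zero]⟩

/-! ### §2 The Manin datum per pair from Cremona's table (the 84 core curves) -/

/-- **The UPPER half of `BSD(E,p)` at every X12 core pair, with NO non-class binder left**: for the
minimal model `W` of a curve of `cremonaCurveOneX12Core` (globally minimal, of conductor `N`), the
Manin datum of `missingUpperBoundAt_of_classX12_of_not_cmRamified'` is supplied by Cremona's table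
— an OPTIMAL parametrisation datum at level `N` with `|c| = 1` (`h26`, `h52`:
`exists_optimal_abs_maninConstant_eq_one_of_mem_x12Core`), whose level is the conductor by
Carayol / modularity (`IsNewformOf.level_eq_conductorNorm_of_exists_isNewformOf hnf`). Remaining
hypotheses: `ClassX12 W p` (its clause `r_an = 1` is analytic), `5 ≤ p`, `p` unramified in the CM
field. All binders `h…` are PUBLISHED named facts. Nothing booked.
[cite: AgasheRibetStein2006, Thm. 2.6 and appendix Thm. 5.2 (pp. 619, 633)]
[cite: MatarNekovar2019, Thm. 0.3 and §0.11] [cite: Miller2011LMS, Def. 1.1] -/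
theorem missingUpperBoundAt_of_mem_cremonaCurveOneX12Core
    (hGZ : ∀ (N : ℕ) [NeZero N] (W : WeierstrassCurve ℚ) (K : Type) [Field K] [NumberField K],
      gross_zagier N W K)
    (hKo : ∀ (N : ℕ) [NeZero N] (W : WeierstrassCurve ℚ) (K : Type) [Field K] [NumberField K],
      kolyvagin N W K)
    (hMN : ∀ (N : ℕ) [NeZero N] (W : WeierstrassCurve ℚ) (K : Type) [Field K] [NumberField K],
      MatarNekovar2019.thm03_padicValNat_card_sha_le_of_irreducible N W K)
    (hGZK : rank_eq_analyticRank_of_analyticRank_le_one) (hmod : hasEntireLFunction_rat)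
    (hnf : exists_isNewformOf) (hFH : friedbergHoffstein_exists_heegnerField_split_twist_ne_zero)
    (hCM8 : bsdTriple_of_hasCM_of_L_one_ne_zero)
    (h26 : cremona_abs_maninConstant_eq_one_of_level_le) (h52 : cremona_optimal_curveOne_x12Core)
    (W : WeierstrassCurve ℚ) [W.IsElliptic] [W.IsGloballyMinimal] (N : ℕ) [NeZero N]
    (hmem : (W, N) ∈ cremonaCurveOneX12Core) (p : ℕ) [Fact p.Prime]
    (hX : ClassX12 W p) (hp5 : 5 ≤ p) (hnr : ¬ CMRamified W p) : MissingUpperBoundAt W p := by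
  obtain ⟨D, -, -, hc⟩ := exists_optimal_abs_maninConstant_eq_one_of_mem_x12Core h26 h52 W N hmem
  have hN : N = W.conductorNorm ℤ :=
    IsNewformOf.level_eq_conductorNorm_of_exists_isNewformOf hnf D.isNewformOf
  subst hN
  exact missingUpperBoundAt_of_classX12_of_not_cmRamified' hGZ hKo hMN hGZK hmod hnf hFH hCM8 W p hX
    hp5 hnr D (hc p Fact.out)

/-- **Route T-KR at every X12 core pair**: for the minimal model `W` of a curve of
`cremonaCurveOneX12Core` with `ClassX12 W p`, `p ≥ 5` unramified in the CM field, and the certified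
datum `#Ш(E)_an = q`, `ord_p q = 0`: `BSD(E,p)`. Inputs beyond published facts: the analytic rank
(inside `ClassX12`) and `ord_p #Ш(E)_an = 0` — NO Heegner index, NO descent, NO Manin hypothesis.
[cite: AgasheRibetStein2006, Thm. 2.6 and appendix Thm. 5.2] [cite: MatarNekovar2019, Thm. 0.3 and §0.11]
[cite: Miller2011LMS, §1 and Def. 1.1] -/
theorem bsdp_of_mem_cremonaCurveOneX12Core_of_shaAn_unit
    (hGZ : ∀ (N : ℕ) [NeZero N] (W : WeierstrassCurve ℚ) (K : Type) [Field K] [NumberField K],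
      gross_zagier N W K)
    (hKo : ∀ (N : ℕ) [NeZero N] (W : WeierstrassCurve ℚ) (K : Type) [Field K] [NumberField K],
      kolyvagin N W K)
    (hMN : ∀ (N : ℕ) [NeZero N] (W : WeierstrassCurve ℚ) (K : Type) [Field K] [NumberField K],
      MatarNekovar2019.thm03_padicValNat_card_sha_le_of_irreducible N W K)
    (hGZK : rank_eq_analyticRank_of_analyticRank_le_one) (hmod : hasEntireLFunction_rat)
    (hnf : exists_isNewformOf) (hFH : friedbergHoffstein_exists_heegnerField_split_twist_ne_zero)
    (hCM8 : bsdTriple_of_hasCM_of_L_one_ne_zero)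
    (h26 : cremona_abs_maninConstant_eq_one_of_level_le) (h52 : cremona_optimal_curveOne_x12Core)
    (W : WeierstrassCurve ℚ) [W.IsElliptic] [W.IsGloballyMinimal] (N : ℕ) [NeZero N]
    (hmem : (W, N) ∈ cremonaCurveOneX12Core) (p : ℕ) [Fact p.Prime]
    (hX : ClassX12 W p) (hp5 : 5 ≤ p) (hnr : ¬ CMRamified W p)
    {q : ℚ} (hq : shaAn W = (q : ℂ)) (hv : padicValRat p q = 0) : BSDp W p := by
  obtain ⟨D, -, -, hc⟩ := exists_optimal_abs_maninConstant_eq_one_of_mem_x12Core h26 h52 W N hmem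
  have hN : N = W.conductorNorm ℤ :=
    IsNewformOf.level_eq_conductorNorm_of_exists_isNewformOf hnf D.isNewformOf
  subst hN
  exact bsdp_of_classX12_of_not_cmRamified_of_shaAn_unit hGZ hKo hMN hGZK hmod hnf hFH hCM8 W p hX
    hp5 hnr D (hc p Fact.out) hq hv

/-! ### §3 (APPEND, gen 9) On the core, `BSD(E,p)` is EQUIVALENT to its lower half -/

/-- **On X12 ∧ `p ≥ 5` ∧ `p` unramified in the CM field, `BSD(E,p)` ⟺ the LOWER half
`MissingLowerBoundAt W p`** (modulo the Manin datum `p ∤ c(D)`; published facts as binders): "⇐" is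
`bsdp_of_classX12_of_not_cmRamified_of_lower'` (the upper half being a theorem), "⇒" is bookkeeping
(`missingPPartAt_of_bsdp`, `Ш` finite by GZK in analytic rank one). The sentence for the cell's
CLASSES.md: on the inert-bad core the missing input IS the main-conjecture half, no more.
[cite: MatarNekovar2019, Thm. 0.3 and §0.11] [cite: Miller2011LMS, §1 and Def. 1.1] -/
theorem bsdp_iff_missingLowerBoundAt_of_classX12_of_not_cmRamified
    (hGZ : ∀ (N : ℕ) [NeZero N] (W : WeierstrassCurve ℚ) (K : Type) [Field K] [NumberField K],
      gross_zagier N W K)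
    (hKo : ∀ (N : ℕ) [NeZero N] (W : WeierstrassCurve ℚ) (K : Type) [Field K] [NumberField K],
      kolyvagin N W K)
    (hMN : ∀ (N : ℕ) [NeZero N] (W : WeierstrassCurve ℚ) (K : Type) [Field K] [NumberField K],
      MatarNekovar2019.thm03_padicValNat_card_sha_le_of_irreducible N W K)
    (hGZK : rank_eq_analyticRank_of_analyticRank_le_one) (hmod : hasEntireLFunction_rat)
    (hnf : exists_isNewformOf) (hFH : friedbergHoffstein_exists_heegnerField_split_twist_ne_zero)
    (hCM8 : bsdTriple_of_hasCM_of_L_one_ne_zero)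
    (W : WeierstrassCurve ℚ) [W.IsElliptic] [W.IsGloballyMinimal] (p : ℕ) [Fact p.Prime]
    [NeZero (W.conductorNorm ℤ)]
    (hX : ClassX12 W p) (hp5 : 5 ≤ p) (hnr : ¬ CMRamified W p)
    (D : ModularParametrizationData W (W.conductorNorm ℤ)) (hc : ¬ (p : ℤ) ∣ D.c) :
    BSDp W p ↔ MissingLowerBoundAt W p := by
  refine ⟨fun h ↦ ?_, fun hlow ↦ bsdp_of_classX12_of_not_cmRamified_of_lower' hGZ hKo hMN hGZK hmod
    hnf hFH hCM8 W p hX hp5 hnr D hc hlow⟩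
  haveI : Finite W.sha := (hGZK W (by rw [hX.2.1])).2
  exact (lower_and_upper_of_missingPPartAt W p (missingPPartAt_of_bsdp W p h)).1

/-- **… and at every core pair (Manin by Cremona's table): `BSD(E,p)` ⟺ `MissingLowerBoundAt W p`.**
[cite: AgasheRibetStein2006, Thm. 2.6 and appendix Thm. 5.2] [cite: Miller2011LMS, §1 and Def. 1.1] -/
theorem bsdp_iff_missingLowerBoundAt_of_mem_cremonaCurveOneX12Core
    (hGZ : ∀ (N : ℕ) [NeZero N] (W : WeierstrassCurve ℚ) (K : Type) [Field K] [NumberField K],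
      gross_zagier N W K)
    (hKo : ∀ (N : ℕ) [NeZero N] (W : WeierstrassCurve ℚ) (K : Type) [Field K] [NumberField K],
      kolyvagin N W K)
    (hMN : ∀ (N : ℕ) [NeZero N] (W : WeierstrassCurve ℚ) (K : Type) [Field K] [NumberField K],
      MatarNekovar2019.thm03_padicValNat_card_sha_le_of_irreducible N W K)
    (hGZK : rank_eq_analyticRank_of_analyticRank_le_one) (hmod : hasEntireLFunction_rat)
    (hnf : exists_isNewformOf) (hFH : friedbergHoffstein_exists_heegnerField_split_twist_ne_zero)
    (hCM8 : bsdTriple_of_hasCM_of_L_one_ne_zero)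
    (h26 : cremona_abs_maninConstant_eq_one_of_level_le) (h52 : cremona_optimal_curveOne_x12Core)
    (W : WeierstrassCurve ℚ) [W.IsElliptic] [W.IsGloballyMinimal] (N : ℕ) [NeZero N]
    (hmem : (W, N) ∈ cremonaCurveOneX12Core) (p : ℕ) [Fact p.Prime]
    (hX : ClassX12 W p) (hp5 : 5 ≤ p) (hnr : ¬ CMRamified W p) :
    BSDp W p ↔ MissingLowerBoundAt W p := by
  obtain ⟨D, -, -, hc⟩ := exists_optimal_abs_maninConstant_eq_one_of_mem_x12Core h26 h52 W N hmem
  have hN : N = W.conductorNorm ℤ :=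
    IsNewformOf.level_eq_conductorNorm_of_exists_isNewformOf hnf D.isNewformOf
  subst hN
  exact bsdp_iff_missingLowerBoundAt_of_classX12_of_not_cmRamified hGZ hKo hMN hGZK hmod hnf hFH hCM8
    W p hX hp5 hnr D (hc p Fact.out)

end Summit.BirchSwinnertonDyer.Rank1Residual.X12

end
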